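import Summits.ResolutionOfSingularities.ResolutionOfSingularities.Theorems.AbhyankarShadowsShadowsUniformizeUniformizerSeparating
import Literature.AlgebraicGeometry.Resolution.ValuedFunctionFieldsLemmas
import HarnessLib

/-!
# A separating transcendence basis in tower form (`stub_separatingTower`)

Stub of the birth line of the crux `ShadowsUniformize` (route `AbhyankarShadows`), branch
`lurelDenseAbhyankar` (Knaf–Kuhlmann 2009, Thm. 1.5: rational places in the completion of an
Abhyankar subfunction field `F₀`). Knaf–Kuhlmann 2009, Prop. 3.11 climbs a separating
transcendence basis of `K' | F₀` one element at a time; this file delivers such a basis in TOWER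
form from the tree predicate `SeparablyGeneratedOver F₀ K'` (`ValuedFunctionFields.lean`).

Setting (ambient rendering of `ValuedFunctionFields.lean`): subfields `F₀ ≤ K'` of a field `Ω`,
`K' | F₀` finitely generated (`FGOver`) and separably generated (`SeparablyGeneratedOver`).

Claim: there are `x₁, …, xₙ ∈ K'` with each `xᵢ` transcendental over `F₀(x_{<i})` (rendered
polynomially: a polynomial over `Ω` with coefficients in `F₀(x_{<i})` vanishing at `xᵢ` is
zero) and `K' | F₀(x₁, …, xₙ)` finite separable (`FiniteSeparableOver`).

Proof: enumerate the separating transcendence basis `t₀` supplied by `SeparablyGeneratedOver`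
as `x : Fin n → Ω` (`Finset.equivFin`); the tower clause is algebraic independence of `x`
(`eq_zero_of_algebraicIndependent_of_notMem`, applied with `S = {j | j < i} ∌ i`), the top clause
is `finiteSeparableOver_closure_of_isSeparable` (the generators of `K' | F₀` are separable over
`F₀(t₀) = F₀(x)`). This is the `t = 0` branch of `stub_uniformizer_separating`.
-/

noncomputable section

-- single-problem summit: the doubled namespace component is forced
set_option linter.dupNamespace false

open Literature.AlgebraicGeometry.Resolution

namespace Summit.ResolutionOfSingularities.ResolutionOfSingularities.Theorems

/-- **A separating transcendence basis in tower form.** For subfields `F₀ ≤ K'` of `Ω` with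
`K' | F₀` finitely generated and separably generated, there are `x₁, …, xₙ ∈ K'` with each `xᵢ`
transcendental over `F₀(x_{<i})` (polynomially rendered) and `K' | F₀(x)` finite separable.
[folklore] -/
theorem stub_separatingTower {Ω : Type} [Field Ω] (F₀ K' : Subfield Ω) (hle : F₀ ≤ K')
    (hfg : FGOver F₀ K') (hsep : SeparablyGeneratedOver F₀ K') :
    ∃ (n : ℕ) (x : Fin n → Ω), (∀ i, x i ∈ K') ∧
      (∀ i : Fin n, ∀ P : Polynomial Ω,
        (∀ m, P.coeff m ∈ Subfield.closure ((F₀ : Set Ω) ∪ x '' {j | j < i})) →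
        P.eval (x i) = 0 → P = 0) ∧
      FiniteSeparableOver (Subfield.closure ((F₀ : Set Ω) ∪ Set.range x)) K' := by
  classical
  -- a separating transcendence basis `t₀` of `K' | F₀`, enumerated as `x : Fin n → Ω`
  obtain ⟨t₀, ht₀F, hind₀, hsep₀⟩ := hsep
  set n := t₀.card
  let e : t₀ ≃ Fin n := t₀.equivFin
  let x : Fin n → Ω := fun i => (e.symm i : Ω)
  have hxF : ∀ i, x i ∈ K' := fun i => ht₀F (e.symm i).2
  have hrange : Set.range x = (t₀ : Set Ω) := by
    ext w; constructor
    · rintro ⟨i, rfl⟩; exact (e.symm i).2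
    · intro hw; exact ⟨e ⟨w, hw⟩, by simp [x]⟩
  have hxind : AlgebraicIndependent F₀ x := hind₀.comp _ e.symm.injective
  refine ⟨n, x, hxF, ?_, ?_⟩
  · -- tower clause: `x i` is transcendental over `F₀(x_{<i})`
    intro i P hP hev
    exact eq_zero_of_algebraicIndependent_of_notMem hxind (S := {j | j < i})
      (fun h => lt_irrefl i h) P hP hev
  · -- top clause: `K' | F₀(x)` is finite separable
    refine finiteSeparableOver_closure_of_isSeparable hle hfg (Set.range_subset_iff.mpr hxF) ?_
    intro z hz
    rw [hrange]
    exact hsep₀ z hz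

end Summit.ResolutionOfSingularities.ResolutionOfSingularities.Theorems

end
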